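import Summits.RiemannHypothesis.RiemannHypothesis.Theorems.WeilFormatCDataO102BFrontData
import Summits.RiemannHypothesis.RiemannHypothesis.Theorems.S2FormatCE0
import Literature.NumberTheory.LFunctions.YoshidaWindowGramTailMSSines
import Literature.NumberTheory.LFunctions.YoshidaWindowGramMiddleJBox
import Literature.NumberTheory.LFunctions.YoshidaWindowGramTailJFactoredScaled
import Literature.NumberTheory.LFunctions.YoshidaWindowGramTailMSFactored
import Literature.NumberTheory.LFunctions.YoshidaWindowGramTailJDiagTight
import Summits.RiemannHypothesis.RiemannHypothesis.Theorems.FormatCPsdBands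
import Summits.RiemannHypothesis.RiemannHypothesis.Theorems.WeilFormatCDiagShift
import HarnessLib

/-!
# Format C kernel rung `O102B` (a = 51/50, column-band layout): odd sector: Schur rows 186…188 (lower triangle) of `M − U₁ − U₂` enclosed by `DS` within `rho`·2^-310 (kernel certificates)

Window `a = 51/50`; prime powers in the window: 2, 3, 2^2, 5, 7; prime constant A = 2148/1000 (`WeilFormatC.primeCoeff_form_ge_cells_v2`); evaluator parameters S = 2^320, Kpi 160, Kser 190, kred 8, Kexp 55, J 150; full table modes < 257; light column table modes < 1027; units 2^-310 (Schur entries), 2^-154 (column digits, width 157), 2^-148 (tail-factor digits, width 151), 2^-64 (reciprocal weights), 2^-40 (tail base); order-J tail J = 4, θ = 1/2048, η = 1/10 | 4/1.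
Design row: sr-gb-rung-a A g23 odd λ-run (parity cell 13 L-side): a = 51/50, μ = 2^-93, odd 256/512/1024, HIGHER precision S 2^320 c 310, MS tail, five prime powers; see HOME(A)/LADDER-CELL12-A-g23.md. Generated by sr-gb-rung-a prover A g22 with rh-explicit-weil-2 gen7's generator extended for the odd λ-run (--sector odd --mu-log2; HOME(A)/code-g22/gen7/gramgen7.py sha16 a23c13b0256hp001) from `#eval` of the tree's `Encl` functions; every datum is re-verified by the kernel in the theorem files (`decide +kernel`). Helper data of the rh-explicit Weil-positivity programme (format C, K-CELL-2), RH-free. [cite: Yoshida1992HermitianForms, §5 (5.15)-(5.16) p. 301; §7 pp. 305–312]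
-/

set_option linter.dupNamespace false
set_option exponentiation.threshold 1024
set_option maxRecDepth 200000

namespace Summit.RiemannHypothesis.RiemannHypothesis.Theorems.WeilFormatCData.O102BCBOdd
open Literature.NumberTheory.LFunctions Literature.NumberTheory.LFunctions.Yoshida1992 Encl Literature.Analysis.ValidatedNumerics.NumericsMP
open Summit.RiemannHypothesis.RiemannHypothesis.Theorems.WeilFormatCData.O102B

/-- kernel: Schur rows `[186, 189)` (columns `j ≤ i`). -/
theorem tS186 : checkSchurBandG (2 ^ 320) 310 O102BCBOdd.rho O102B.C O102B.tab true 256 (subBoxCB (2 ^ 320) 157 256 154 64 O102BCBOdd.ρc O102BCBOdd.XP O102BCBOdd.Pd O102BCBOdd.v O102BCBOdd.V 151 8 148 148 O102BCBOdd.ρφ O102BCBOdd.ρψ O102BCBOdd.ΦP O102BCBOdd.ΨP O102BCBOdd.Pφ O102BCBOdd.Pψ (fun i ↦ (dMidOBox (2 ^ 320) O102B.C O102B.F (tget O102B.tab (i + 1)) 1 1024 256 4 O102B.momO i).add (dgJoBoxT (2 ^ 320) O102B.C O102B.F (tget O102B.tab (i + 1)) 40 1346682168655 256 1024 4 1 2048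 i))) O102BCBOdd.DS true 186 3 = true := by
  decide +kernel

end Summit.RiemannHypothesis.RiemannHypothesis.Theorems.WeilFormatCData.O102BCBOdd
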